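import Summits.BirchSwinnertonDyer.BirchSwinnertonDyer.Theorems.SmallImageMuTransferMuTransferX9StepFourReciprocity
import Summits.BirchSwinnertonDyer.BirchSwinnertonDyer.Theorems.SmallImageMuTransferMuTransferX9LocalTwistOperator
import Literature.NumberTheory.EllipticCurves.IwasawaTwistModPDual
import Literature.NumberTheory.EllipticCurves.IwasawaTwistModPTower
import HarnessLib

/-!
# K6 crux `MuTransferX9` (stmt-BirchSwinnertonDyer-19276), MU-TRANSFER-PROOF §5 STEP 4 on the
# GENUINE coefficients: the Poitou–Tate term at the auxiliary prime `q` of a pair of classes of the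
# Iwasawa twists `𝒯_J(ρ, κ) × 𝒯_J(ρ′, κ⁻¹) → μ_p` (k6-ty's `twistContPairing` / `twistDualMap`)
# vanishes — for every ODD prime `p` (so at `p = 3` as well as `p ≥ 5`)

Cell `b2b-bsdres`, unit `b2b-bsdres-x10` (N2 = X10b at `p = 3` class lead, GEN 38), serving the cell
`bsd-smallim` (route `SmallImageMuTransfer`, rung K6, deciding crux 19276 `MuTransferX9`, skeleton v4
sha16 0154dd5daf38efd6, open stub `stub_coreX9`; piece G4 = STEP 4 of the assembler's cut). Sequel of
`…X9StepFourReciprocity` (the generic bookkeeping at odd level): THIS FILE instantiates it to the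
currency of the core — `bsd-smallim-k6-ty`'s Iwasawa twists `κ.twistModP ρ hM J` (`𝒯_J(ρ, κ)`), the
dual twist by `κ⁻¹ = κ.invTwist`, the Gorenstein pairing `gorensteinPairing e J` through an equivariant
`e : M × M′ → μ_p` (for the core: `M = M′ = E[p]`, `e` the Weil pairing), its continuous pairing
`twistContPairing` and dual map `twistDualMap : 𝒯_J(ρ′, κ⁻¹) → 𝒯_J(ρ, κ)^D` (`IwasawaTwistModPDual`),
and the shift `T` on `H¹` (`shiftH1`, `IwasawaTwistModPTower`). HONEST FRAMING: TOOL theorems; no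
definition, no named fact, no `sorry`; nothing is asserted about any curve, nothing is booked; X9 stays
TYPED at class level, X10b (N2) keeps its label CONSTRUCTION-SHAPED / NEEDS X_A3.
`--supports stmt-BirchSwinnertonDyer-19276` (helper; closes nothing). PARTITION (D-0054): X9 (A4) ×
`p ∈ {5, 7}` · X10b (A5) × `p = 3` — the statements are prime-generic (`p` odd).

## Content (all for a number field `K`, `κ : ZpExtension K p`, `p` an odd prime, `inv : LocalInvariants K p`
## with the Poitou–Tate vanishing `inv.SumLocalTermEqZero`, `S` finite places, `q` a finite place)

* §1 inertia: at a finite `v ∤ p` where `ρ` is unramified, the twist `𝒯_J(ρ, κ)` is unramified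
  (`isUnramifiedAt_twistModP`, from koly's `LocalSplitPrime.toLocal_twistModP_apply_of_mem_absInertia`,
  Washington Prop. 13.2) and inertia fixes its Tate dual (team n1011's
  `UnramifiedCup.toLocal_tateDual_apply_of_mem_absInertia_of_not_mem`); `p·𝒯_J = 0`; iterates of the
  shift `T` keep unramified localisations (`iterate_shiftH1_localization_mem_unramifiedSubgroup`);
* §2 **`localTerm_twistDualMap_eq_zero_of_unramified_outside`** — for `x ∈ H¹(K, 𝒯_J(ρ, κ))`,
  `y ∈ H¹(K, 𝒯_J(ρ′, κ⁻¹))` with unramified localisations at every finite `v ∉ S`, `v ≠ q` (there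
  `v ∤ p` and `ρ` unramified) and `loc_v y = 0` for `v ∈ S`: the local term at `q` of
  `(x, (twistDualMap)_* y)` vanishes; **`localTerm_iterate_shiftH1_twistDualMap_eq_zero_of_unramified_outside`**
  — the same for `(T^k x, y)`, EVERY `k` (the coefficient family `Φ_{J−1−k}` of MU-TRANSFER-PROOF (F7)
  / koly's assembly recipe, STATUS 12:17Z); and the raw-inertia-hypothesis forms;
* §3 the cup-product forms `inv_q(loc_q(x ∪ y)) = 0`, `inv_q(loc_q(T^k x ∪ y)) = 0` for k6-ty's
  `twistContPairing` into `μ_p` (statements under `[LocallyCompactSpace Γ_K]`, which holds —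
  `absoluteGaloisGroup_compactSpace K` — and is a `Prop`).

For the core (`K = ℚ`, `M = M′ = E[p]`, `S` = bad primes ∪ {p}`, `x = κ_q` of G3, `y = T^ε ψ` of G1,
`q` the Chebotarev prime of G2 = x9's `…X9StepTwoElementKernels`): every member of the family
`Φ_k(κ_q, T^ε ψ) = inv_q(T^{J−1−k} κ_q ∪ T^ε ψ)` vanishes, which with koly's Lemma 1 (iii)
(`u(T)·⟨·,·⟩_{A_J}`, `…X9PairingUniqueness` / `…X9LocalSplitNaturality` / `…X9LocalTransversePerfect`)
is «every coefficient of `U·T^{ε+e+a}·⟨k₁, c_y(Fr_q)⟩_{A_J}` vanishes» = the hypothesis `hq` of the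
kernel schema `LevelE.theoremA_contradiction_schema`. NOT done here: `q`, `κ_q`, `ψ`, Lemma 1 (iii),
the final packaging (the assembler `bsd-smallim-k6-c2`, skeleton v5).

References: HOME pub/bsd-smallim/koly/MU-TRANSFER-PROOF.md §5 STEP 4, (F7), (4.1); J. S. Milne,
*Arithmetic Duality Theorems* (2006), I Thm. 4.10 (b), Thm. 2.6 [MilneADT2006]; L. Washington,
*Introduction to Cyclotomic Fields*, Prop. 13.2 [Washington1997]; B. Mazur, K. Rubin, Mem. AMS 799
(2004), §1.3, Thm. 2.3.4 [MazurRubin2004]; X10-AUDIT.md §44.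
-/

-- the summit and its single problem are both named `BirchSwinnertonDyer` (registry layout D-0017)
set_option linter.dupNamespace false

set_option autoImplicit false

noncomputable section

open scoped ContRepresentation
open Function NumberField IsDedekindDomain Field
open scoped NumberField
open Literature.NumberTheory.GaloisRepresentations
open Literature.NumberTheory.GaloisRepresentations.DiscreteGaloisModule (mu MuCarrier pairing TateDual
  tateDual pairingDualIntertwining)
open Literature.NumberTheory.GaloisCohomology
open Literature.NumberTheory.EllipticCurves
open Summit.BirchSwinnertonDyer.Rank1Residual.GaloisImage

universe u

namespace Summit.BirchSwinnertonDyer.BirchSwinnertonDyer.Rank1Residual.StepFour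

variable {K : Type u} [Field K] [NumberField K] {p : ℕ} [Fact p.Prime] (κ : ZpExtension K p)
variable {M M' : Type u} [AddCommGroup M] [TopologicalSpace M] [DiscreteTopology M] [Finite M]
  [AddCommGroup M'] [TopologicalSpace M'] [DiscreteTopology M']
variable (ρ : DiscreteGaloisModule K M) (ρ' : DiscreteGaloisModule K M')
  (hM : ∀ x : M, p • x = 0) (hM' : ∀ x : M', p • x = 0) (J : ℕ)

/-! ### §1 Inertia and torsion bookkeeping for the twists -/

omit [Fact p.Prime] [TopologicalSpace M] [DiscreteTopology M] [Finite M] in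
include hM in
/-- `p · 𝒯_J = 0` (coordinatewise `p · M = 0`). [cite: Washington1997, §13.1–§13.2] -/
theorem nsmul_twist_eq_zero (z : Fin J → M) : p • z = 0 := by
  funext i
  exact hM (z i)

omit [Finite M] in
/-- **`𝒯_J(ρ, κ)` is unramified at a finite `v ∤ p` where `ρ` is** (Washington Prop. 13.2: `κ` kills the
inertia group at `v ∤ p`; koly's `LocalSplitPrime.toLocal_twistModP_apply_of_mem_absInertia`), as the
tree's predicate `GaloisRep.IsUnramifiedAt`. [cite: Washington1997, Prop. 13.2] -/
theorem isUnramifiedAt_twistModP (v : HeightOneSpectrum (𝓞 K)) (hur : GaloisRep.IsUnramifiedAt v ρ)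
    (hvp : ((p : ℕ) : 𝓞 K) ∉ v.asIdeal) : GaloisRep.IsUnramifiedAt v (κ.twistModP ρ hM J) := by
  refine (GaloisRep.isUnramifiedAt_iff_toLocal_holds v (κ.twistModP ρ hM J)).2 fun t ht => ?_
  refine LinearMap.ext fun z => ?_
  rw [Module.End.one_apply]
  exact LocalSplitPrime.toLocal_twistModP_apply_of_mem_absInertia ρ hM κ J v hur hvp ht z

omit [Finite M] in
/-- Inertia at a finite `v ∤ p` where `ρ` is unramified fixes `𝒯_J(ρ, κ)` pointwise (koly's lemma,
re-exported in the shape of the generic file's hypothesis `hI`). [cite: Washington1997, Prop. 13.2] -/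
theorem toLocal_twistModP_apply_of_mem_absInertia (v : HeightOneSpectrum (𝓞 K))
    (hur : GaloisRep.IsUnramifiedAt v ρ) (hvp : ((p : ℕ) : 𝓞 K) ∉ v.asIdeal)
    {t : absoluteGaloisGroup (v.adicCompletion K)} (ht : t ∈ absInertia (v.adicCompletion K))
    (z : Fin J → M) : GaloisRep.toLocal v (κ.twistModP ρ hM J) t z = z :=
  LocalSplitPrime.toLocal_twistModP_apply_of_mem_absInertia ρ hM κ J v hur hvp ht z

/-- Inertia at a finite `v ∤ p` where `ρ` is unramified fixes the Tate dual `𝒯_J(ρ, κ)^D = Hom(𝒯_J, μ_p)`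
(team n1011's `UnramifiedCup.toLocal_tateDual_apply_of_mem_absInertia_of_not_mem`, Serre LF IV §4;
the generic file's hypothesis `hID`). [cite: MilneADT2006, Ch. I, Thm. 2.6] -/
theorem toLocal_tateDual_twistModP_apply_of_mem_absInertia (v : HeightOneSpectrum (𝓞 K))
    (hur : GaloisRep.IsUnramifiedAt v ρ) (hvp : ((p : ℕ) : 𝓞 K) ∉ v.asIdeal)
    {t : absoluteGaloisGroup (v.adicCompletion K)} (ht : t ∈ absInertia (v.adicCompletion K))
    (f : TateDual K (Fin J → M) p) : GaloisRep.toLocal v ((κ.twistModP ρ hM J).tateDual p) t f = f :=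
  UnramifiedCup.toLocal_tateDual_apply_of_mem_absInertia_of_not_mem (κ.twistModP ρ hM J) p v hvp
    (isUnramifiedAt_twistModP κ ρ hM J v hur hvp) ht f

omit [Finite M] in
/-- **Iterates of the shift `T` keep unramified localisations**: if `loc_v x ∈ H¹_ur` then
`loc_v (T^k x) ∈ H¹_ur` for every `k` (`shiftH1 = H¹(twistModPShift)`, an equivariant endomorphism;
`localization_map_mem_unramifiedSubgroup`). [cite: SerreGaloisCohomology1997, I §2.2] -/
theorem iterate_shiftH1_localization_mem_unramifiedSubgroup (v : HeightOneSpectrum (𝓞 K))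
    {x : galoisCohomology (κ.twistModP ρ hM J) 1}
    (hx : galoisCohomology.localization (κ.twistModP ρ hM J) (Sum.inr v) 1 x ∈
      DiscreteGaloisModule.unramifiedSubgroup (GaloisRep.toLocal v (κ.twistModP ρ hM J)) 1) (k : ℕ) :
    galoisCohomology.localization (κ.twistModP ρ hM J) (Sum.inr v) 1 ((κ.shiftH1 ρ hM J)^[k] x) ∈
      DiscreteGaloisModule.unramifiedSubgroup (GaloisRep.toLocal v (κ.twistModP ρ hM J)) 1 := by
  induction k with
  | zero => exact hx
  | succ k ih =>
    rw [Function.iterate_succ_apply']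
    exact localization_map_mem_unramifiedSubgroup (κ.twistModPShift ρ hM J) v ih

/-! ### §2 STEP 4 for the twists, local-term form -/

section Pairing

variable {e : M →+ M' →+ MuCarrier K p}
  (he : ∀ (g : absoluteGaloisGroup K) (m : M) (m' : M'), e (ρ g m) (ρ' g m') = mu K p g (e m m'))
include he

/-- **MU-TRANSFER-PROOF §5 STEP 4 on the Iwasawa twists (raw inertia hypotheses).** `p` odd, `inv` with
the Poitou–Tate vanishing; `x ∈ H¹(K, 𝒯_J(ρ, κ))`, `y ∈ H¹(K, 𝒯_J(ρ′, κ⁻¹))` with unramified localisations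
at every finite `v ∉ S`, `v ≠ q` at which inertia fixes `𝒯_J(ρ, κ)` and its Tate dual, and `loc_v y = 0`
for `v ∈ S`. Then the local term at `q` of `(x, (twistDualMap)_* y)` — `= inv_q(loc_q(x ∪ y))` for the
Gorenstein pairing — vanishes. [cite: MilneADT2006, Ch. I, Thm. 4.10(b)] -/
theorem localTerm_twistDualMap_eq_zero_of_unramified_outside' (hp : p ≠ 2)
    {inv : LocalInvariants K p} (hPT : inv.SumLocalTermEqZero)
    (S : Finset (HeightOneSpectrum (𝓞 K))) (q : HeightOneSpectrum (𝓞 K))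
    (x : galoisCohomology (κ.twistModP ρ hM J) 1)
    (y : galoisCohomology (κ.invTwist.twistModP ρ' hM' J) 1)
    (hI : ∀ v ∉ S, v ≠ q → ∀ t ∈ absInertia (v.adicCompletion K), ∀ z : Fin J → M,
      GaloisRep.toLocal v (κ.twistModP ρ hM J) t z = z)
    (hID : ∀ v ∉ S, v ≠ q → ∀ t ∈ absInertia (v.adicCompletion K), ∀ f : TateDual K (Fin J → M) p,
      GaloisRep.toLocal v ((κ.twistModP ρ hM J).tateDual p) t f = f)
    (hx : ∀ v ∉ S, v ≠ q → galoisCohomology.localization (κ.twistModP ρ hM J) (Sum.inr v) 1 x ∈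
      DiscreteGaloisModule.unramifiedSubgroup (GaloisRep.toLocal v (κ.twistModP ρ hM J)) 1)
    (hy : ∀ v ∉ S, v ≠ q →
      galoisCohomology.localization (κ.invTwist.twistModP ρ' hM' J) (Sum.inr v) 1 y ∈
        DiscreteGaloisModule.unramifiedSubgroup (GaloisRep.toLocal v (κ.invTwist.twistModP ρ' hM' J)) 1)
    (hS : ∀ v ∈ S, galoisCohomology.localization (κ.invTwist.twistModP ρ' hM' J) (Sum.inr v) 1 y = 0) :
    inv.localTerm (κ.twistModP ρ hM J) (Sum.inr q) x
      (galoisCohomology.map (κ.twistDualMap ρ ρ' p hM hM' J he) 1 y) = 0 := by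
  haveI : NeZero p := ⟨(Fact.out : p.Prime).ne_zero⟩
  exact localTerm_pairingDual_eq_zero_of_unramified_outside
    (κ.gorensteinPairing_twistModP_smul ρ ρ' (mu K p) hM hM' J he) ((Fact.out : p.Prime).odd_of_ne_two hp)
    hPT (nsmul_twist_eq_zero hM J) S q x y hI hID hx hy hS

/-- **MU-TRANSFER-PROOF §5 STEP 4 on the Iwasawa twists.** `p` odd, `inv` with the Poitou–Tate
vanishing, `S` a finite set of finite places containing every `v ∣ p` and every place of ramification
of `ρ` other than possibly `q` (`hSp`, `hur`); `x ∈ H¹(K, 𝒯_J(ρ, κ))`, `y ∈ H¹(K, 𝒯_J(ρ′, κ⁻¹))` with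
unramified localisations off `S ∪ {q}` and `loc_v y = 0` on `S`. Then **the local term at `q` of
`(x, (twistDualMap)_* y)` vanishes**. [cite: MilneADT2006, Ch. I, Thm. 4.10(b)] -/
theorem localTerm_twistDualMap_eq_zero_of_unramified_outside (hp : p ≠ 2)
    {inv : LocalInvariants K p} (hPT : inv.SumLocalTermEqZero)
    (S : Finset (HeightOneSpectrum (𝓞 K))) (q : HeightOneSpectrum (𝓞 K))
    (hSp : ∀ v ∉ S, v ≠ q → ((p : ℕ) : 𝓞 K) ∉ v.asIdeal)
    (hur : ∀ v ∉ S, v ≠ q → GaloisRep.IsUnramifiedAt v ρ)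
    (x : galoisCohomology (κ.twistModP ρ hM J) 1)
    (y : galoisCohomology (κ.invTwist.twistModP ρ' hM' J) 1)
    (hx : ∀ v ∉ S, v ≠ q → galoisCohomology.localization (κ.twistModP ρ hM J) (Sum.inr v) 1 x ∈
      DiscreteGaloisModule.unramifiedSubgroup (GaloisRep.toLocal v (κ.twistModP ρ hM J)) 1)
    (hy : ∀ v ∉ S, v ≠ q →
      galoisCohomology.localization (κ.invTwist.twistModP ρ' hM' J) (Sum.inr v) 1 y ∈
        DiscreteGaloisModule.unramifiedSubgroup (GaloisRep.toLocal v (κ.invTwist.twistModP ρ' hM' J)) 1)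
    (hS : ∀ v ∈ S, galoisCohomology.localization (κ.invTwist.twistModP ρ' hM' J) (Sum.inr v) 1 y = 0) :
    inv.localTerm (κ.twistModP ρ hM J) (Sum.inr q) x
      (galoisCohomology.map (κ.twistDualMap ρ ρ' p hM hM' J he) 1 y) = 0 :=
  localTerm_twistDualMap_eq_zero_of_unramified_outside' κ ρ ρ' hM hM' J he hp hPT S q x y
    (fun v hvS hvq _ ht z =>
      toLocal_twistModP_apply_of_mem_absInertia κ ρ hM J v (hur v hvS hvq) (hSp v hvS hvq) ht z)
    (fun v hvS hvq _ ht f =>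
      toLocal_tateDual_twistModP_apply_of_mem_absInertia κ ρ hM J v (hur v hvS hvq) (hSp v hvS hvq) ht f)
    hx hy hS

/-- **STEP 4 on the twists, the coefficient family**: under the hypotheses of
`localTerm_twistDualMap_eq_zero_of_unramified_outside` on `(x, y)`, the local term at `q` of
`(T^k x, (twistDualMap)_* y)` vanishes for EVERY `k` — the members
`Φ_{J−1−k}(κ_q, T^ε ψ) = inv_q(T^k κ_q ∪ T^ε ψ)` of the family of MU-TRANSFER-PROOF (F7).
[cite: MilneADT2006, Ch. I, Thm. 4.10(b)] -/
theorem localTerm_iterate_shiftH1_twistDualMap_eq_zero_of_unramified_outside (hp : p ≠ 2)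
    {inv : LocalInvariants K p} (hPT : inv.SumLocalTermEqZero)
    (S : Finset (HeightOneSpectrum (𝓞 K))) (q : HeightOneSpectrum (𝓞 K))
    (hSp : ∀ v ∉ S, v ≠ q → ((p : ℕ) : 𝓞 K) ∉ v.asIdeal)
    (hur : ∀ v ∉ S, v ≠ q → GaloisRep.IsUnramifiedAt v ρ)
    (x : galoisCohomology (κ.twistModP ρ hM J) 1)
    (y : galoisCohomology (κ.invTwist.twistModP ρ' hM' J) 1)
    (hx : ∀ v ∉ S, v ≠ q → galoisCohomology.localization (κ.twistModP ρ hM J) (Sum.inr v) 1 x ∈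
      DiscreteGaloisModule.unramifiedSubgroup (GaloisRep.toLocal v (κ.twistModP ρ hM J)) 1)
    (hy : ∀ v ∉ S, v ≠ q →
      galoisCohomology.localization (κ.invTwist.twistModP ρ' hM' J) (Sum.inr v) 1 y ∈
        DiscreteGaloisModule.unramifiedSubgroup (GaloisRep.toLocal v (κ.invTwist.twistModP ρ' hM' J)) 1)
    (hS : ∀ v ∈ S, galoisCohomology.localization (κ.invTwist.twistModP ρ' hM' J) (Sum.inr v) 1 y = 0)
    (k : ℕ) :
    inv.localTerm (κ.twistModP ρ hM J) (Sum.inr q) ((κ.shiftH1 ρ hM J)^[k] x)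
      (galoisCohomology.map (κ.twistDualMap ρ ρ' p hM hM' J he) 1 y) = 0 :=
  localTerm_twistDualMap_eq_zero_of_unramified_outside κ ρ ρ' hM hM' J he hp hPT S q hSp hur _ y
    (fun v hvS hvq => iterate_shiftH1_localization_mem_unramifiedSubgroup κ ρ hM J v (hx v hvS hvq) k)
    hy hS

/-! ### §3 Cup-product forms for k6-ty's `twistContPairing` into `μ_p` -/

variable [LocallyCompactSpace (absoluteGaloisGroup K)]

/-- **STEP 4 on the twists, cup-product form**: `inv_q(loc_q(x ∪ y)) = 0` for the Gorenstein pairing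
`twistContPairing` of `𝒯_J(ρ, κ) × 𝒯_J(ρ′, κ⁻¹)` into `μ_p`. [cite: MilneADT2006, Ch. I, Thm. 4.10(b)] -/
theorem inv_localization_cupProduct_twistContPairing_eq_zero_of_unramified_outside (hp : p ≠ 2)
    {inv : LocalInvariants K p} (hPT : inv.SumLocalTermEqZero)
    (S : Finset (HeightOneSpectrum (𝓞 K))) (q : HeightOneSpectrum (𝓞 K))
    (hSp : ∀ v ∉ S, v ≠ q → ((p : ℕ) : 𝓞 K) ∉ v.asIdeal)
    (hur : ∀ v ∉ S, v ≠ q → GaloisRep.IsUnramifiedAt v ρ)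
    (x : galoisCohomology (κ.twistModP ρ hM J) 1)
    (y : galoisCohomology (κ.invTwist.twistModP ρ' hM' J) 1)
    (hx : ∀ v ∉ S, v ≠ q → galoisCohomology.localization (κ.twistModP ρ hM J) (Sum.inr v) 1 x ∈
      DiscreteGaloisModule.unramifiedSubgroup (GaloisRep.toLocal v (κ.twistModP ρ hM J)) 1)
    (hy : ∀ v ∉ S, v ≠ q →
      galoisCohomology.localization (κ.invTwist.twistModP ρ' hM' J) (Sum.inr v) 1 y ∈
        DiscreteGaloisModule.unramifiedSubgroup (GaloisRep.toLocal v (κ.invTwist.twistModP ρ' hM' J)) 1)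
    (hS : ∀ v ∈ S, galoisCohomology.localization (κ.invTwist.twistModP ρ' hM' J) (Sum.inr v) 1 y = 0) :
    inv (Sum.inr q) (galoisCohomology.localization (mu K p) (Sum.inr q) 2
      ((κ.twistContPairing ρ ρ' (mu K p) hM hM' J he).cupProduct x y)) = 0 := by
  have h := localTerm_twistDualMap_eq_zero_of_unramified_outside κ ρ ρ' hM hM' J he hp hPT S q hSp hur
    x y hx hy hS
  rw [show κ.twistDualMap ρ ρ' p hM hM' J he = pairingDualIntertwining
      (κ.gorensteinPairing_twistModP_smul ρ ρ' (mu K p) hM hM' J he) from rfl,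
    DiscreteGaloisModule.localTerm_pairingDual] at h
  exact h

/-- **STEP 4 on the twists, cup-product form of the coefficient family**: `inv_q(loc_q(T^k x ∪ y)) = 0`
for every `k`. [cite: MilneADT2006, Ch. I, Thm. 4.10(b)] -/
theorem inv_localization_cupProduct_twistContPairing_iterate_shiftH1_eq_zero (hp : p ≠ 2)
    {inv : LocalInvariants K p} (hPT : inv.SumLocalTermEqZero)
    (S : Finset (HeightOneSpectrum (𝓞 K))) (q : HeightOneSpectrum (𝓞 K))
    (hSp : ∀ v ∉ S, v ≠ q → ((p : ℕ) : 𝓞 K) ∉ v.asIdeal)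
    (hur : ∀ v ∉ S, v ≠ q → GaloisRep.IsUnramifiedAt v ρ)
    (x : galoisCohomology (κ.twistModP ρ hM J) 1)
    (y : galoisCohomology (κ.invTwist.twistModP ρ' hM' J) 1)
    (hx : ∀ v ∉ S, v ≠ q → galoisCohomology.localization (κ.twistModP ρ hM J) (Sum.inr v) 1 x ∈
      DiscreteGaloisModule.unramifiedSubgroup (GaloisRep.toLocal v (κ.twistModP ρ hM J)) 1)
    (hy : ∀ v ∉ S, v ≠ q →
      galoisCohomology.localization (κ.invTwist.twistModP ρ' hM' J) (Sum.inr v) 1 y ∈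
        DiscreteGaloisModule.unramifiedSubgroup (GaloisRep.toLocal v (κ.invTwist.twistModP ρ' hM' J)) 1)
    (hS : ∀ v ∈ S, galoisCohomology.localization (κ.invTwist.twistModP ρ' hM' J) (Sum.inr v) 1 y = 0)
    (k : ℕ) :
    inv (Sum.inr q) (galoisCohomology.localization (mu K p) (Sum.inr q) 2
      ((κ.twistContPairing ρ ρ' (mu K p) hM hM' J he).cupProduct ((κ.shiftH1 ρ hM J)^[k] x) y)) = 0 :=
  inv_localization_cupProduct_twistContPairing_eq_zero_of_unramified_outside κ ρ ρ' hM hM' J he hp hPT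
    S q hSp hur _ y
    (fun v hvS hvq => iterate_shiftH1_localization_mem_unramifiedSubgroup κ ρ hM J v (hx v hvS hvq) k)
    hy hS

end Pairing

end Summit.BirchSwinnertonDyer.BirchSwinnertonDyer.Rank1Residual.StepFour

end
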